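/-
  stub-ideation k = 2 (g42) · technique «literature transfer (recent-theorem-open-question harvest;
  typed dictionary)» · crux `SplitBadTwoLowerHalfOfFacts` · stub `stub_heegnerIndexLowerAtTwo`.

  WHAT THIS FILE DOES (nothing here proves BSD, the crux, or the stub): road A′'s conjunct text of
  record `IsCosetValues` (k2-g40 `CosetValuesK2G40`, row 118, de Shalit II.5.2 (4) on the 𝔭-ramified
  finite-order cosets) quantifies over twelve binders with side conditions.  STUB-PLAN v7.4 / row 118
  price (P-ii) «R223-H» asks for the three instantiation lemmas H2 → H1 → H3.  This file PROVES them
  (0 sorry) by the tree's class-field-theory layer, H1 by a GLOBAL FROBENIUS POWER `Frob_𝔓ⁿ ∈ Γ_K`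
  (Serre I §2.1 / Neukirch I (9.4): one element serving EVERY modulus prime to `v`, no compactness),
  derives from H2 the DISCHARGE of the clause's tower-continuity hypothesis along the fact's own tower
  `(U_n open, ⋂ U_n ⊆ rayKer K p S)`, instantiates the remaining structural binders (`L, La, T` period
  data, the orientation `ζ`), and assembles the CONSUMER FORM: from `IsCosetValues` on the witness of
  `thmII414_exists_lMeasure_cosetValues`, for every key `(ιK, 𝔣, n, 𝔞, χ)` there EXIST witnesses
  `(L, La, T, u, ζ, γ₀, α)` with the value identity II.5.2 (4) — so the appended conjunct has content on
  the fact's witness (not vacuous) and frame (i-c) can read `∫χ̂⁻¹dμ = c(key)·G(χ⁻¹)·Σ` off it.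
  §0 copies k2-g40's eight node definitions TOKEN-FOR-TOKEN (the port P51 keeps ONE copy).
-/
import Literature.NumberTheory.EllipticCurves.DeShalit1987.LMeasureExistence
import Literature.NumberTheory.EllipticCurves.DeShalit1987.RayClassTower
import Literature.NumberTheory.ComplexMultiplication.EllipticUnits.ThetaSingularValues
import Literature.NumberTheory.ComplexMultiplication.EllipticUnits.RingOfIntegersPeriodLattice
import Literature.NumberTheory.ComplexMultiplication.EllipticUnits.RubinEulerSystem
import Literature.NumberTheory.LocalFields.PadicComplexLog
import Literature.NumberTheory.GaloisRepresentations.IntegralGaloisActionProofs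
import Literature.NumberTheory.GaloisRepresentations.ArtinReciprocityCharacterFiniteProofs
import Literature.NumberTheory.GaloisRepresentations.GlobalArtinMapOfCharactersProofs
import Literature.NumberTheory.GaloisRepresentations.CyclotomicFrobenius
import HarnessLib

noncomputable section

open scoped Classical
open NumberField IsDedekindDomain Field Complex
open Literature.NumberTheory.GaloisRepresentations
open Literature.NumberTheory.EllipticCurves
open Literature.NumberTheory.ComplexMultiplication.EllipticUnits
open Literature.NumberTheory.NumberFields (rayClassField isUnramifiedIn_rayClassField)
open Literature.NumberTheory.LFunctions.AbelianDensity (artinSymbol artinSymbol_finsuppProd)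
open Literature.NumberTheory.LocalFields (PadicComplex.iwasawaLog)

set_option linter.dupNamespace false

namespace Summit.BirchSwinnertonDyer.BirchSwinnertonDyer.Cruxes.SplitBadTwoLowerHalfOfFacts.CosetInstancesK2G42

variable {p : ℕ} [Fact p.Prime] {K : Type} [Field K] [NumberField K]

/-! ## §0 The node definitions of record (k2-g40 `CosetValuesK2G40`, VERBATIM; one copy at port P51) -/

/-- `ι⁻¹ z ∈ ℂ_p` for a unit `z ∈ ℂˣ` (values of finite-order characters). -/
def cval (ι : PadicAlgCl p ≃+* ℂ) (z : ℂˣ) : ℂ_[p] :=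
  ((ι.symm ((z : ℂˣ) : ℂ) : PadicAlgCl p) : ℂ_[p])

/-- The `p`-adic embedding `j_p = ι⁻¹ ∘ ι̂ : K̄ → ℂ → ℂ_p` attached to `ιK : K → ℂ`. -/
def pEmb (ι : PadicAlgCl p ≃+* ℂ) (ιK : K →+* ℂ) (x : AlgebraicClosure K) : ℂ_[p] :=
  ((ι.symm (algClosureEmb ιK x) : PadicAlgCl p) : ℂ_[p])

/-- The Galois group `Gal(K(𝔤)/K)` of the ray class field (finite abelian). -/
abbrev RayGal (K : Type) [Field K] [NumberField K] (𝔤 : Ideal (𝓞 K)) : Type :=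
  rayClassField K 𝔤 ≃ₐ[K] rayClassField K 𝔤

/-- The integrand `ρ = χ̂⁻¹ : Γ_K → ℂ_p` of a character `χ` of `Gal(K(𝔤)/K)`. -/
def galCharInv (ι : PadicAlgCl p ≃+* ℂ) (𝔤 : Ideal (𝓞 K)) (χ : RayGal K 𝔤 →* ℂˣ) :
    absoluteGaloisGroup K → ℂ_[p] :=
  fun σ ↦ cval ι (χ (absRestrictNormalHom (rayClassField K 𝔤) σ))⁻¹

/-- The Gauss sum `G(χ⁻¹)` — de Shalit II.4.11 (30) ≡ 4.8 (19), `γ₀`-coset form. -/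
def gaussSumInv (ι : PadicAlgCl p ≃+* ℂ) (ιK : K →+* ℂ) (𝔤 : Ideal (𝓞 K)) (n : ℕ)
    (χ : RayGal K 𝔤 →* ℂˣ) (γ₀ : absoluteGaloisGroup K) (ζ : AlgebraicClosure K)
    (α : (ZMod (p ^ n))ˣ → 𝓞 K) : ℂ_[p] :=
  ((p : ℂ_[p]) ^ n)⁻¹ * cval ι (χ (absRestrictNormalHom (rayClassField K 𝔤) γ₀))⁻¹ *
    ∑ a : (ZMod (p ^ n))ˣ,
      cval ι (χ (artinSymbol (galFrob K (rayClassField K 𝔤)) (Ideal.span {α a})))⁻¹ *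
        ((pEmb ι ιK (γ₀ • ζ)) ^ (a : ZMod (p ^ n)).val)⁻¹

/-- `Σ_{g ∈ Gal(K(𝔤)/K)} ι⁻¹χ(g) · Log j_p(g u)` — the elliptic-unit side of II.5.2 (4). -/
def unitLogSum (ι : PadicAlgCl p ≃+* ℂ) (ιK : K →+* ℂ) (𝔤 : Ideal (𝓞 K))
    (χ : RayGal K 𝔤 →* ℂˣ) (u : rayClassField K 𝔤) : ℂ_[p] :=
  ∑ g : RayGal K 𝔤,
    cval ι (χ g) * PadicComplex.iwasawaLog p (pEmb ι ιK ((g u : rayClassField K 𝔤) : AlgebraicClosure K))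

/-- One table entry: de Shalit II.5.2 (4) at exact `𝔭`-level `n ≥ 1`. -/
def CosetValueIdentity (ι : PadicAlgCl p ≃+* ℂ) (ιK : K →+* ℂ) (𝔤 : Ideal (𝓞 K)) (n : ℕ)
    (𝔞 : Ideal (𝓞 K)) (χ : RayGal K 𝔤 →* ℂˣ) (u : rayClassField K 𝔤)
    (γ₀ : absoluteGaloisGroup K) (ζ : AlgebraicClosure K) (α : (ZMod (p ^ n))ˣ → 𝓞 K)
    {𝒰 : SubgroupTower (absoluteGaloisGroup K)} (μ : GroupDistribution 𝒰 ℂ_[p]) : Prop :=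
  12 * (cval ι (χ (artinSymbol (galFrob K (rayClassField K 𝔤)) 𝔞))⁻¹ - (Ideal.absNorm 𝔞 : ℂ_[p])) *
      μ.integral (galCharInv ι 𝔤 χ) =
    gaussSumInv ι ιK 𝔤 n χ γ₀ ζ α * unitLogSum ι ιK 𝔤 χ u

/-- **A′ = «(KLF-COSET)₂», the conjunct** (k2-g40's text of record, verbatim). -/
def IsCosetValues (ι : PadicAlgCl p ≃+* ℂ) (v vbar : HeightOneSpectrum (𝓞 K))
    (S : Finset (HeightOneSpectrum (𝓞 K))) (𝒰 : SubgroupTower (absoluteGaloisGroup K))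
    (μ : GroupDistribution 𝒰 ℂ_[p]) : Prop :=
  ∀ (ιK : K →+* ℂ), (∀ k : 𝓞 K, k ∈ v.asIdeal ↔ ‖ι.symm (ιK (k : K))‖ < 1) →
  ∀ (𝔣 : Ideal (𝓞 K)) (n : ℕ), 1 ≤ n → 𝔣 ≠ ⊥ → IsCoprime 𝔣 v.asIdeal →
    (∀ w : HeightOneSpectrum (𝓞 K), w.asIdeal ∣ 𝔣 ↔ (w ∈ S ∨ w = vbar)) →
    rootsOfUnityCongruentOne 𝔣 = 1 →
  ∀ (𝔞 : Ideal (𝓞 K)), IsCoprime 𝔞 (Ideal.span {(6 : 𝓞 K)} * (𝔣 * v.asIdeal ^ n)) →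
  ∀ (L La : PeriodPair) (T : Finset ℂ),
    (∀ z : ℂ, z ∈ L.lattice ↔ ∃ a ∈ 𝔣 * v.asIdeal ^ n, z = ιK (a : K)) →
    La.lattice = idealInvLattice ιK 𝔞 L.lattice → L.IsLatticeReps La T →
  ∀ (u : rayClassField K (𝔣 * v.asIdeal ^ n)),
    algClosureEmb ιK (u : AlgebraicClosure K) = L.deShalitTheta La T 1 →
  ∀ (χ : RayGal K (𝔣 * v.asIdeal ^ n) →* ℂˣ),
    (∃ δ ∈ relGalSet K (𝔣 * v.asIdeal ^ n) (𝔣 * v.asIdeal ^ (n - 1)), χ δ ≠ 1) →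
    𝒰.IsTowerContinuous (galCharInv ι (𝔣 * v.asIdeal ^ n) χ) →
  ∀ (ζ : AlgebraicClosure K),
    algClosureEmb ιK ζ = Complex.exp (2 * Real.pi * Complex.I / (p : ℂ) ^ n) →
  ∀ (γ₀ : absoluteGaloisGroup K),
    (∀ m : ℕ, absRestrictNormalHom (rayClassField K (𝔣 * vbar.asIdeal ^ m)) γ₀ =
      artinSymbol (galFrob K (rayClassField K (𝔣 * vbar.asIdeal ^ m))) (v.asIdeal ^ n)) →
  ∀ (α : (ZMod (p ^ n))ˣ → 𝓞 K),
    (∀ a, α a - 1 ∈ 𝔣 ∧ α a - ((a : ZMod (p ^ n)).val : 𝓞 K) ∈ v.asIdeal ^ n) →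
  CosetValueIdentity ι ιK (𝔣 * v.asIdeal ^ n) n 𝔞 χ u γ₀ ζ α μ

/-! ## §1 H2 (R223-H): `rayKer K p S ≤ ker(Γ_K → Gal(K(𝔤)/K))` for `supp 𝔤 ⊆ S ∪ {v, v̄}` -/

omit [Fact p.Prime] in
/-- **H2 = k2-g40 `stubsig_rayKer_le_ker`, PROVED.**  Dictionary: de Shalit's `𝒢 = Gal(K(𝔣p^∞)/K)`
(II.4.12 Remark (i), II.4.16) ↦ `Γ_K ⧸ rayKer K p S`; «`χ` of conductor dividing `𝔤 = 𝔣𝔭ⁿ` is a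
character of `𝒢`» ↦ the tree's `DeShalit1987.rayKer_le_ker_absRestrictNormalHom_rayClassField`
(Neukirch VI (6.6): `K(𝔤)` is abelian, unramified at every `w ∤ 𝔤`), specialised to a modulus whose
prime support lies in `S ∪ {v, v̄}`. [cite: deShalit1987, II.4.12 Remark (i) (p. 67)]
[cite: NeukirchANT1999, Ch. VI §6 Cor. (6.6)] -/
theorem rayKer_le_ker (S : Finset (HeightOneSpectrum (𝓞 K))) (v vbar : HeightOneSpectrum (𝓞 K))
    (hv : ((p : ℕ) : 𝓞 K) ∈ v.asIdeal) (hvbar : ((p : ℕ) : 𝓞 K) ∈ vbar.asIdeal)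
    (𝔤 : Ideal (𝓞 K)) (h𝔤 : 𝔤 ≠ ⊥)
    (hsupp : ∀ w : HeightOneSpectrum (𝓞 K), w.asIdeal ∣ 𝔤 → w ∈ S ∨ w = v ∨ w = vbar) :
    DeShalit1987.rayKer K p S ≤ (absRestrictNormalHom (rayClassField K 𝔤)).ker :=
  DeShalit1987.rayKer_le_ker_absRestrictNormalHom_rayClassField p S h𝔤 fun w hwS hwp hle ↦ by
    rcases hsupp w (Ideal.dvd_iff_le.mpr hle) with h | rfl | rfl
    · exact hwS h
    · exact hwp hv
    · exact hwp hvbar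

omit [Fact p.Prime] in
/-- The support clause of `IsCosetValues` (`w ∣ 𝔣 ↔ w ∈ S ∨ w = v̄`) gives the support hypothesis of
H2 for `𝔤 = 𝔣vⁿ`. [cite: deShalit1987, II.5.2 (p. 79)] -/
theorem supp_mul_pow {S : Finset (HeightOneSpectrum (𝓞 K))} {v vbar : HeightOneSpectrum (𝓞 K)}
    {𝔣 : Ideal (𝓞 K)} (hsupp : ∀ w : HeightOneSpectrum (𝓞 K), w.asIdeal ∣ 𝔣 ↔ (w ∈ S ∨ w = vbar))
    (n : ℕ) (w : HeightOneSpectrum (𝓞 K)) (hw : w.asIdeal ∣ 𝔣 * v.asIdeal ^ n) :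
    w ∈ S ∨ w = v ∨ w = vbar := by
  rcases (Ideal.IsPrime.mul_le w.isPrime).mp (Ideal.dvd_iff_le.mp hw) with h | h
  · rcases (hsupp w).mp (Ideal.dvd_iff_le.mpr h) with h' | h'
    · exact Or.inl h'
    · exact Or.inr (Or.inr h')
  · have hle : v.asIdeal ≤ w.asIdeal := w.isPrime.le_of_pow_le h
    have hmax : v.asIdeal.IsMaximal := v.isPrime.isMaximal v.ne_bot
    exact Or.inr (Or.inl (HeightOneSpectrum.ext (hmax.eq_of_le w.isPrime.ne_top hle)).symm)

/-! ## §2 H2′: the tower-continuity hypothesis of `IsCosetValues` is DISCHARGED on the fact's tower -/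

/-- **Tower-continuity of `χ̂⁻¹` along the fact's `𝒰`.**  For the tower of
`thmII414_exists_lMeasure(_cosetValues)` (`U_n` open, `⋂ U_n ⊆ rayKer K p S`) and `supp 𝔤 ⊆ S ∪ {v, v̄}`,
the integrand `galCharInv ι 𝔤 χ` is tower-continuous: it is CONSTANT on the cosets of the open
subgroup `ker(Γ_K → Gal(K(𝔤)/K)) ⊇ rayKer K p S` (H2), and the tower is cofinal among open sets above
`rayKer` (`SubgroupTower.IsTowerContinuous.of_cofinal`, Cantor).  So the clause's hypothesis
`𝒰.IsTowerContinuous (galCharInv …)` costs the consumer nothing. [cite: deShalit1987, II.4.16 (49) (p. 76), II.5.2 (p. 79)] -/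
theorem isTowerContinuous_galCharInv (ι : PadicAlgCl p ≃+* ℂ) {S : Finset (HeightOneSpectrum (𝓞 K))}
    {v vbar : HeightOneSpectrum (𝓞 K)} (hv : ((p : ℕ) : 𝓞 K) ∈ v.asIdeal)
    (hvbar : ((p : ℕ) : 𝓞 K) ∈ vbar.asIdeal) {𝔤 : Ideal (𝓞 K)} (h𝔤 : 𝔤 ≠ ⊥)
    (hsupp : ∀ w : HeightOneSpectrum (𝓞 K), w.asIdeal ∣ 𝔤 → w ∈ S ∨ w = v ∨ w = vbar)
    (χ : RayGal K 𝔤 →* ℂˣ) {𝒰 : SubgroupTower (absoluteGaloisGroup K)}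
    (hU : ∀ n, IsOpen (𝒰.U n : Set (absoluteGaloisGroup K)))
    (hN : ⋂ n, (𝒰.U n : Set (absoluteGaloisGroup K)) ⊆ DeShalit1987.rayKer K p S) :
    𝒰.IsTowerContinuous (galCharInv ι 𝔤 χ) := by
  refine SubgroupTower.IsTowerContinuous.of_cofinal hU hN fun ε hε ↦
    ⟨((absRestrictNormalHom (rayClassField K 𝔤)).ker : Set (absoluteGaloisGroup K)),
      isOpen_ker_absRestrictNormalHom _, fun ν hν ↦ rayKer_le_ker S v vbar hv hvbar 𝔤 h𝔤 hsupp hν,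
      fun σ τ hστ ↦ ?_⟩
  have h : absRestrictNormalHom (rayClassField K 𝔤) σ = absRestrictNormalHom (rayClassField K 𝔤) τ := by
    have h1 : (absRestrictNormalHom (rayClassField K 𝔤)) (σ⁻¹ * τ) = 1 := hστ
    rwa [map_mul, map_inv, inv_mul_eq_one] at h1
  simp only [galCharInv, h, dist_self, hε]

/-! ## §2b (d1) READING: `∫ χ̂⁻¹ dμ` along the fact's tower IS a finite Riemann sum (I.3.1) -/

/-- **(d1), kernel half.**  Row 118 deferred to the typer «that `GroupDistribution.integral` along `𝒰`
of a tower-continuous `χ̂⁻¹` IS `∫_{𝒢(𝔣)} χ⁻¹ dμ(𝔣)`».  On the fact's tower there is a level `N` with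
`U_N ⊆ ker(Γ_K → Gal(K(𝔤)/K))` (H2 + cofinality), `χ̂⁻¹` factors through `Γ_K ⧸ U_N`, and the
`limUnder`-integral EQUALS the level-`N` Riemann sum `Σ_{a ∈ Γ_K/U_N} μ_N(a)·χ⁻¹(repr a|_{K(𝔤)})` —
de Shalit's own definition of integrating a locally constant function (I.3.1 «if `G` is finite
`Λ(G, M) ≃ M[G]`»).  What remains of (d1) is only the Γ_K-presentation of `μ(𝔣)` that `IsLMeasure`
already fixes. [cite: deShalit1987, I.3.1 (p. 16); II.4.16 (49) (p. 76)] -/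
theorem exists_integral_galCharInv_eq_sum (ι : PadicAlgCl p ≃+* ℂ)
    {S : Finset (HeightOneSpectrum (𝓞 K))} {v vbar : HeightOneSpectrum (𝓞 K)}
    (hv : ((p : ℕ) : 𝓞 K) ∈ v.asIdeal) (hvbar : ((p : ℕ) : 𝓞 K) ∈ vbar.asIdeal) {𝔤 : Ideal (𝓞 K)}
    (h𝔤 : 𝔤 ≠ ⊥) (hsupp : ∀ w : HeightOneSpectrum (𝓞 K), w.asIdeal ∣ 𝔤 → w ∈ S ∨ w = v ∨ w = vbar)
    (χ : RayGal K 𝔤 →* ℂˣ) {𝒰 : SubgroupTower (absoluteGaloisGroup K)}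
    (hU : ∀ n, IsOpen (𝒰.U n : Set (absoluteGaloisGroup K)))
    (hN : ⋂ n, (𝒰.U n : Set (absoluteGaloisGroup K)) ⊆ DeShalit1987.rayKer K p S)
    (μ : GroupDistribution 𝒰 ℂ_[p]) :
    ∃ N : ℕ, (𝒰.U N : Set (absoluteGaloisGroup K)) ⊆ (absRestrictNormalHom (rayClassField K 𝔤)).ker ∧
      μ.integral (galCharInv ι 𝔤 χ) =
        ∑ a ∈ 𝒰.cells N, μ.μ N a * galCharInv ι 𝔤 χ (𝒰.repr N a) := by
  obtain ⟨N, hNk⟩ := 𝒰.exists_subset_of_isOpen hU hN (isOpen_ker_absRestrictNormalHom _)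
    (fun ν hν ↦ rayKer_le_ker S v vbar hv hvbar 𝔤 h𝔤 hsupp hν)
  refine ⟨N, hNk, μ.integral_eq_sum_of_factorsThrough
    (fun a ↦ galCharInv ι 𝔤 χ (𝒰.repr N a)) fun x ↦ ?_⟩
  have hmem : (𝒰.repr N (𝒰.proj N x))⁻¹ * x ∈ 𝒰.U N :=
    𝒰.proj_eq_iff.mp (𝒰.proj_repr N _)
  have h1 : absRestrictNormalHom (rayClassField K 𝔤) ((𝒰.repr N (𝒰.proj N x))⁻¹ * x) = 1 := hNk hmem
  rw [map_mul, map_inv, inv_mul_eq_one] at h1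
  simp only [galCharInv, h1]

/-! ## §2c (d2): the `κ`-representatives `α_a` are prime to `𝔤 = 𝔣vⁿ` (no junk Artin symbol) -/

omit [Fact p.Prime] [NumberField K] in
/-- `α_a ∉ v`: `α_a ≡ a (vⁿ)` with `a` a unit mod `pⁿ`, `n ≥ 1`, `p ∈ v`. [folklore] -/
theorem not_mem_of_kappaRep {v : HeightOneSpectrum (𝓞 K)} (hv : ((p : ℕ) : 𝓞 K) ∈ v.asIdeal)
    {n : ℕ} (hn : 1 ≤ n) (a : (ZMod (p ^ n))ˣ) {x : 𝓞 K}
    (hx : x - ((a : ZMod (p ^ n)).val : 𝓞 K) ∈ v.asIdeal ^ n) : x ∉ v.asIdeal := by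
  intro hxv
  obtain ⟨s, t, hst⟩ :
      IsCoprime ((((a : ZMod (p ^ n)).val : ℕ) : 𝓞 K)) (((p ^ n : ℕ) : 𝓞 K)) :=
    (ZMod.val_coe_unit_coprime a).cast
  have ha : (((a : ZMod (p ^ n)).val : ℕ) : 𝓞 K) ∈ v.asIdeal := by
    have := v.asIdeal.sub_mem hxv (Ideal.pow_le_self (by omega : n ≠ 0) hx)
    rwa [sub_sub_cancel] at this
  have hp : ((p ^ n : ℕ) : 𝓞 K) ∈ v.asIdeal := by
    rw [Nat.cast_pow]; exact v.asIdeal.pow_mem_of_mem hv n (by omega)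
  have h1 : (1 : 𝓞 K) ∈ v.asIdeal :=
    hst ▸ v.asIdeal.add_mem (v.asIdeal.mul_mem_left s ha) (v.asIdeal.mul_mem_left t hp)
  exact v.isPrime.ne_top ((Ideal.eq_top_iff_one _).mpr h1)

omit [Fact p.Prime] in
/-- **(d2), kernel half.**  Row 118 deferred «the tree's `artinSymbol` on the principal ideal `(α_a)`
(total function; `α_a` prime to `𝔤` so no junk value is met)»: the clause's `α`-conditions
(`α_a ≡ 1 (𝔣)`, `α_a ≡ a (vⁿ)`) give `((α_a), 𝔣vⁿ) = 1`, so `artinSymbol (galFrob K (K(𝔤))) (α_a)` is a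
product of Frobenii at primes UNRAMIFIED in `K(𝔤)` — the genuine Artin symbol `δ_a`.
[cite: deShalit1987, II.4.11 (30) (p. 65–66)] [cite: NeukirchANT1999, Ch. VI §7 (7.1)] -/
theorem isCoprime_span_kappaRep {v : HeightOneSpectrum (𝓞 K)} (hv : ((p : ℕ) : 𝓞 K) ∈ v.asIdeal)
    {n : ℕ} (hn : 1 ≤ n) {𝔣 : Ideal (𝓞 K)} (a : (ZMod (p ^ n))ˣ) {x : 𝓞 K} (hx1 : x - 1 ∈ 𝔣)
    (hx : x - ((a : ZMod (p ^ n)).val : 𝓞 K) ∈ v.asIdeal ^ n) :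
    IsCoprime (Ideal.span {x}) (𝔣 * v.asIdeal ^ n) := by
  refine IsCoprime.mul_right ?_ (IsCoprime.pow_right ?_)
  · exact Ideal.isCoprime_iff_exists.mpr
      ⟨x, Ideal.mem_span_singleton_self x, 1 - x, by simpa using 𝔣.neg_mem hx1, by ring⟩
  · rw [Ideal.isCoprime_iff_sup_eq]
    have hmax : v.asIdeal.IsMaximal := v.isPrime.isMaximal v.ne_bot
    refine hmax.1.2 _ (lt_of_le_of_ne le_sup_right fun h ↦ not_mem_of_kappaRep hv hn a hx ?_)
    rw [h]; exact le_sup_left (b := v.asIdeal) (Ideal.mem_span_singleton_self x)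

/-! ## §3 H1 (R223-H): the lift `γ₀` — a GLOBAL FROBENIUS POWER `Frob_𝔓ⁿ ∈ Γ_K` -/

/-- `F(𝔭ⁿ) = f(𝔭)ⁿ` for the multiplicative extension `artinSymbol`. [folklore] -/
theorem artinSymbol_asIdeal_pow {G : Type*} [CommGroup G]
    (f : HeightOneSpectrum (𝓞 K) → G) (v : HeightOneSpectrum (𝓞 K)) (n : ℕ) :
    artinSymbol f (v.asIdeal ^ n) = f v ^ n := by
  have h := artinSymbol_finsuppProd f (Finsupp.single v n)
  simp only [Finsupp.prod_single_index, pow_zero] at h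
  exact h

/-- **Frobenius restricts to Frobenius** (public form of the tree's private
`HilbertClassFieldMaximal.absRestrictNormalHom_eq_galFrob`): an arithmetic Frobenius `σ ∈ Γ_K` at a
prime `𝔓` of `ℤ̄_K` above `v` restricts, on every finite ABELIAN `L ⊆ K̄` unramified at `v`, to THE
Frobenius `galFrob K L v`. [cite: NeukirchANT1999, Ch. I §9 (9.5)] [cite: SerreAbelianLadic1968, Ch. I §2.1] -/
theorem absRestrictNormalHom_eq_galFrob (L : IntermediateField K (AlgebraicClosure K))
    [FiniteDimensional K L] [IsAbelianGalois K L] [NumberField L] {v : HeightOneSpectrum (𝓞 K)}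
    (hunr : Algebra.IsUnramifiedIn (𝓞 L) v.asIdeal) {𝔓 : Ideal (absIntegers (𝓞 K) K)}
    (h𝔓 : 𝔓 ∈ v.primesAbove) {σ : absoluteGaloisGroup K} (hσ : IsArithFrobAt (𝓞 K) σ 𝔓) :
    absRestrictNormalHom L σ = galFrob K L v := by
  haveI : 𝔓.IsPrime := h𝔓.1
  exact eq_galFrob (commute_of_isAbelianGalois L) hunr
    (comap_ringOfIntegersToIntegralClosure_mem_primesOver_of_mem_primesAbove _ h𝔓)
    (isArithFrobAt_absRestrictNormalHom _ hσ)

/-- **The universal Frobenius-power lift.**  ONE element `γ₀ = Frob_𝔓ⁿ ∈ Γ_K` (`𝔓` a prime of `ℤ̄_K`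
above `v`, `Frob_𝔓` an arithmetic Frobenius — it exists: Serre I §2.1, the tree's
`exists_isArithFrobAt_of_mem_primesAbove_holds`) restricts to the Artin symbol `(vⁿ, K(𝔪)/K)` on the
ray class field of EVERY modulus `𝔪 ≠ 0` not divisible by `v` — de Shalit's `φ = (𝔭, F′/K)` on
`F′ = K(𝔣𝔭̄^∞)` read as the restriction of a global Frobenius. [cite: deShalit1987, II.4.11 (30) (p. 65–66)]
[cite: SerreAbelianLadic1968, Ch. I §2.1] [cite: NeukirchANT1999, Ch. I §9 Prop. (9.4)] -/
theorem exists_frobPowLift (v : HeightOneSpectrum (𝓞 K)) (n : ℕ) :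
    ∃ γ₀ : absoluteGaloisGroup K, ∀ (𝔪 : Ideal (𝓞 K)), 𝔪 ≠ ⊥ → ¬ 𝔪 ≤ v.asIdeal →
      absRestrictNormalHom (rayClassField K 𝔪) γ₀ =
        artinSymbol (galFrob K (rayClassField K 𝔪)) (v.asIdeal ^ n) := by
  obtain ⟨𝔓, h𝔓⟩ := v.primesAbove_nonempty
  obtain ⟨σ, hσ⟩ := HeightOneSpectrum.exists_isArithFrobAt_of_mem_primesAbove_holds h𝔓
  refine ⟨σ ^ n, fun 𝔪 h𝔪 hv ↦ ?_⟩
  rw [map_pow, artinSymbol_asIdeal_pow,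
    absRestrictNormalHom_eq_galFrob _ (isUnramifiedIn_rayClassField h𝔪 hv) h𝔓 hσ]

omit [Fact p.Prime] in
/-- `v ∤ 𝔣v̄^m` for `𝔣` prime to `v` and `v̄ ≠ v`. [folklore] -/
theorem not_mul_pow_le {𝔣 : Ideal (𝓞 K)} {v vbar : HeightOneSpectrum (𝓞 K)}
    (hv : IsCoprime 𝔣 v.asIdeal) (hne : vbar ≠ v) (m : ℕ) : ¬ 𝔣 * vbar.asIdeal ^ m ≤ v.asIdeal := by
  intro h
  rcases (Ideal.IsPrime.mul_le v.isPrime).mp h with h1 | h1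
  · have htop : (⊤ : Ideal (𝓞 K)) ≤ v.asIdeal :=
      (Ideal.isCoprime_iff_sup_eq.mp hv).symm.le.trans (sup_le h1 le_rfl)
    exact v.isPrime.ne_top (top_le_iff.mp htop)
  · have hle : vbar.asIdeal ≤ v.asIdeal := v.isPrime.le_of_pow_le h1
    have hmax : vbar.asIdeal.IsMaximal := vbar.isPrime.isMaximal vbar.ne_bot
    exact hne (HeightOneSpectrum.ext (hmax.eq_of_le v.isPrime.ne_top hle))

/-- **H1 = k2-g40 `stubsig_exists_frobLift`, PROVED** (signature verbatim): the `γ₀`-binder of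
`IsCosetValues` — compatible Artin symbols `(vⁿ, K(𝔣v̄^m)/K)` for ALL `m` — is witnessed by `Frob_𝔓ⁿ`.
[cite: deShalit1987, II.4.11 (30) (p. 65–66)] [cite: SerreAbelianLadic1968, Ch. I §2.1] -/
theorem exists_frobLift (𝔣 : Ideal (𝓞 K)) (h𝔣 : 𝔣 ≠ ⊥) (v vbar : HeightOneSpectrum (𝓞 K))
    (hv : IsCoprime 𝔣 v.asIdeal) (hne : vbar ≠ v) (n : ℕ) :
    ∃ γ₀ : absoluteGaloisGroup K, ∀ m : ℕ,
      absRestrictNormalHom (rayClassField K (𝔣 * vbar.asIdeal ^ m)) γ₀ =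
        artinSymbol (galFrob K (rayClassField K (𝔣 * vbar.asIdeal ^ m))) (v.asIdeal ^ n) := by
  obtain ⟨γ₀, hγ₀⟩ := exists_frobPowLift v n
  exact ⟨γ₀, fun m ↦ hγ₀ _ (mul_ne_zero h𝔣 (pow_ne_zero m vbar.ne_bot)) (not_mul_pow_le hv hne m)⟩

/-! ## §4 H3 (R223-H): the elliptic unit `e_n(𝔞) = Θ(1; 𝔤, 𝔞) ∈ K(𝔤)`, and the period data -/

omit [Fact p.Prime] in
/-- **H3 = k2-g40 `stubsig_exists_unit`, PROVED** (signature verbatim; XS on the named fact II.2.4 (i)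
`DeShalit1987.prop24_i_mem_rayClassField`): `ιK(𝔤)` is a CM lattice (`isCMLattice_of_mem_iff`), `1` is
a primitive `𝔤`-division point of it (`isPrimitiveDivisionPoint_one_of_mem_iff`, Kato (15.3.1)), and
`(𝔞, 6𝔤) = 1 ⇒ (𝔞, 𝔤) = 1`; then `exists_mem_rayClassField_eq_deShalitTheta`.
[cite: deShalit1987, II.2.4 Proposition (i) (p. 46), II.5.2 (p. 80)] -/
theorem exists_unit (h24 : DeShalit1987.prop24_i_mem_rayClassField)
    (hK : IsImaginaryQuadratic K) (ιK : K →+* ℂ) (𝔤 𝔞 : Ideal (𝓞 K)) (h𝔤 : 𝔤 ≠ ⊥) (h𝔤' : 𝔤 ≠ ⊤)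
    (h𝔞 : 𝔞 ≠ ⊥) (hcop : IsCoprime 𝔞 (Ideal.span {(6 : 𝓞 K)} * 𝔤)) (L La : PeriodPair) (T : Finset ℂ)
    (hL : ∀ z : ℂ, z ∈ L.lattice ↔ ∃ a ∈ 𝔤, z = ιK (a : K))
    (hLa : La.lattice = idealInvLattice ιK 𝔞 L.lattice) (hT : L.IsLatticeReps La T) :
    ∃ u : rayClassField K 𝔤, algClosureEmb ιK (u : AlgebraicClosure K) = L.deShalitTheta La T 1 :=
  exists_mem_rayClassField_eq_deShalitTheta h24 hK ιK (isCMLattice_of_mem_iff hL) h𝔤 h𝔤'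
    (isPrimitiveDivisionPoint_one_of_mem_iff hL) h𝔞 hcop.of_mul_right_right hLa hT

omit [Fact p.Prime] in
/-- **The period/unit binders `(L, La, T, u)` of `IsCosetValues` are jointly instantiable**: a period
pair with lattice `ιK(𝔤)` (`exists_periodPair_mem_iff_ideal`), one with lattice `𝔞⁻¹ιK(𝔤)`
(`exists_periodPair_lattice_eq_idealInvLattice`), representatives `T ∋ 0` of `𝔞⁻¹L/L`
(`PeriodPair.IsLatticeReps.exists`), and the unit (H3). [cite: deShalit1987, II.2.3 (10), II.2.4 (i), II.5.2 (4)] -/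
theorem exists_thetaData (h24 : DeShalit1987.prop24_i_mem_rayClassField)
    (hK : IsImaginaryQuadratic K) (ιK : K →+* ℂ) {𝔤 𝔞 : Ideal (𝓞 K)} (h𝔤 : 𝔤 ≠ ⊥) (h𝔤' : 𝔤 ≠ ⊤)
    (h𝔞 : 𝔞 ≠ ⊥) (hcop : IsCoprime 𝔞 (Ideal.span {(6 : 𝓞 K)} * 𝔤)) :
    ∃ (L La : PeriodPair) (T : Finset ℂ) (u : rayClassField K 𝔤),
      (∀ z : ℂ, z ∈ L.lattice ↔ ∃ a ∈ 𝔤, z = ιK (a : K)) ∧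
      La.lattice = idealInvLattice ιK 𝔞 L.lattice ∧ L.IsLatticeReps La T ∧
      algClosureEmb ιK (u : AlgebraicClosure K) = L.deShalitTheta La T 1 := by
  obtain ⟨L, hL⟩ := exists_periodPair_mem_iff_ideal hK ιK h𝔤
  obtain ⟨La, hLa⟩ := exists_periodPair_lattice_eq_idealInvLattice (isCMLattice_of_mem_iff hL) h𝔞
  have hle : L.lattice ≤ La.lattice := by
    rw [hLa]; exact le_idealInvLattice (isCMLattice_of_mem_iff hL) 𝔞
  obtain ⟨T, hT⟩ := PeriodPair.IsLatticeReps.exists hle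
  obtain ⟨u, hu⟩ := exists_unit h24 hK ιK 𝔤 𝔞 h𝔤 h𝔤' h𝔞 hcop L La T hL hLa hT
  exact ⟨L, La, T, u, hL, hLa, hT, hu⟩

/-! ## §5 The orientation binder `ζ` (`ι̂ ζ = e^{2πi/pⁿ}`, II.4.4) is instantiable -/

omit [NumberField K] in
/-- **An orientation exists in `K̄`**: `e^{2πi/pⁿ}` is a `pⁿ`-th root of `1 = ι̂(1)`, hence `ι̂ ζ` for
some `ζ ∈ K̄` (`exists_algClosureEmb_eq_of_pow_eq`). [cite: deShalit1987, II.4.4 (p. 58)] -/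
theorem exists_orientation (ιK : K →+* ℂ) (n : ℕ) :
    ∃ ζ : AlgebraicClosure K,
      algClosureEmb ιK ζ = Complex.exp (2 * Real.pi * Complex.I / (p : ℂ) ^ n) := by
  have hp : (p : ℂ) ^ n ≠ 0 := pow_ne_zero _ (Nat.cast_ne_zero.mpr (Fact.out : p.Prime).ne_zero)
  refine exists_algClosureEmb_eq_of_pow_eq ιK (pow_pos (Fact.out : p.Prime).pos n) (y := 1) ?_
  have hmul : ((p ^ n : ℕ) : ℂ) * (2 * Real.pi * Complex.I / (p : ℂ) ^ n) = 2 * Real.pi * Complex.I := by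
    rw [Nat.cast_pow]; field_simp
  rw [map_one, ← Complex.exp_nat_mul, hmul, Complex.exp_two_pi_mul_I]

/-! ## §6 The CONSUMER FORM: `IsCosetValues` on the fact's witness yields a value identity per key -/

omit [Fact p.Prime] [NumberField K] in
/-- `𝔣vⁿ ≠ 𝒪_K` for `n ≥ 1`. [folklore] -/
theorem mul_pow_ne_top {𝔣 : Ideal (𝓞 K)} {v : HeightOneSpectrum (𝓞 K)} {n : ℕ} (hn : 1 ≤ n) :
    𝔣 * v.asIdeal ^ n ≠ ⊤ := fun h ↦
  v.isPrime.ne_top (top_le_iff.mp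
    (h.symm.le.trans (Ideal.mul_le_left.trans (Ideal.pow_le_self (by omega)))))

/-- **A′ is consumable (every binder witnessed, the analytic hypothesis derived).**  Let `μ` carry
`IsCosetValues ι v vbar S 𝒰 μ` along a tower with `U_n` open and `⋂ U_n ⊆ rayKer K p S` (the clauses of
`thmII414_exists_lMeasure_cosetValues`).  Then for EVERY key — complex embedding `ιK` inducing `v`,
modulus `𝔣` (`≠ 0`, prime to `v`, support exactly `S ∪ {v̄}`, `w_𝔣 = 1`), level `n ≥ 1`, smoothing
ideal `𝔞 ≠ 0` prime to `6𝔣vⁿ`, character `χ` of exact `v`-level `n` — there EXIST period data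
`L, La, T`, the elliptic unit `u = e_n(𝔞) ∈ K(𝔣vⁿ)`, an orientation `ζ`, a Frobenius lift `γ₀` and
`κ`-representatives `α`, all satisfying the clause's side conditions, with de Shalit's identity
II.5.2 (4) `12(χ⁻¹(𝔞) − N𝔞)·∫χ̂⁻¹dμ = G(χ⁻¹)·Σ_g χ(g) log(g·u)` holding for them.  Uses H1, H2′, H3, §5
and k2-g40's CRT lemma (re-proved inline).  Modulo the one named fact II.2.4 (i).
[cite: deShalit1987, II.5.2 Theorem, proof eq. (4) (p. 80); II.4.11 (30); II.2.4 (i)] -/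
theorem exists_cosetValueIdentity (h24 : DeShalit1987.prop24_i_mem_rayClassField)
    (hK : IsImaginaryQuadratic K) {ι : PadicAlgCl p ≃+* ℂ} {v vbar : HeightOneSpectrum (𝓞 K)}
    (hv : ((p : ℕ) : 𝓞 K) ∈ v.asIdeal) (hvbar : ((p : ℕ) : 𝓞 K) ∈ vbar.asIdeal) (hne : vbar ≠ v)
    {S : Finset (HeightOneSpectrum (𝓞 K))} {𝒰 : SubgroupTower (absoluteGaloisGroup K)}
    {μ : GroupDistribution 𝒰 ℂ_[p]} (hU : ∀ n, IsOpen (𝒰.U n : Set (absoluteGaloisGroup K)))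
    (hN : ⋂ n, (𝒰.U n : Set (absoluteGaloisGroup K)) ⊆ DeShalit1987.rayKer K p S)
    (hcv : IsCosetValues ι v vbar S 𝒰 μ)
    (ιK : K →+* ℂ) (hιK : ∀ k : 𝓞 K, k ∈ v.asIdeal ↔ ‖ι.symm (ιK (k : K))‖ < 1)
    (𝔣 : Ideal (𝓞 K)) (n : ℕ) (hn : 1 ≤ n) (h𝔣 : 𝔣 ≠ ⊥) (h𝔣v : IsCoprime 𝔣 v.asIdeal)
    (hsupp : ∀ w : HeightOneSpectrum (𝓞 K), w.asIdeal ∣ 𝔣 ↔ (w ∈ S ∨ w = vbar))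
    (hw : rootsOfUnityCongruentOne 𝔣 = 1)
    (𝔞 : Ideal (𝓞 K)) (h𝔞 : 𝔞 ≠ ⊥) (hcop : IsCoprime 𝔞 (Ideal.span {(6 : 𝓞 K)} * (𝔣 * v.asIdeal ^ n)))
    (χ : RayGal K (𝔣 * v.asIdeal ^ n) →* ℂˣ)
    (hχ : ∃ δ ∈ relGalSet K (𝔣 * v.asIdeal ^ n) (𝔣 * v.asIdeal ^ (n - 1)), χ δ ≠ 1) :
    ∃ (L La : PeriodPair) (T : Finset ℂ) (u : rayClassField K (𝔣 * v.asIdeal ^ n))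
      (ζ : AlgebraicClosure K) (γ₀ : absoluteGaloisGroup K) (α : (ZMod (p ^ n))ˣ → 𝓞 K),
      (∀ z : ℂ, z ∈ L.lattice ↔ ∃ a ∈ 𝔣 * v.asIdeal ^ n, z = ιK (a : K)) ∧
      La.lattice = idealInvLattice ιK 𝔞 L.lattice ∧ L.IsLatticeReps La T ∧
      algClosureEmb ιK (u : AlgebraicClosure K) = L.deShalitTheta La T 1 ∧
      algClosureEmb ιK ζ = Complex.exp (2 * Real.pi * Complex.I / (p : ℂ) ^ n) ∧
      (∀ m : ℕ, absRestrictNormalHom (rayClassField K (𝔣 * vbar.asIdeal ^ m)) γ₀ =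
        artinSymbol (galFrob K (rayClassField K (𝔣 * vbar.asIdeal ^ m))) (v.asIdeal ^ n)) ∧
      (∀ a, α a - 1 ∈ 𝔣 ∧ α a - ((a : ZMod (p ^ n)).val : 𝓞 K) ∈ v.asIdeal ^ n) ∧
      CosetValueIdentity ι ιK (𝔣 * v.asIdeal ^ n) n 𝔞 χ u γ₀ ζ α μ := by
  have h𝔤 : 𝔣 * v.asIdeal ^ n ≠ ⊥ := mul_ne_zero h𝔣 (pow_ne_zero n v.ne_bot)
  obtain ⟨L, La, T, u, hL, hLa, hT, hu⟩ :=
    exists_thetaData h24 hK ιK h𝔤 (mul_pow_ne_top hn) h𝔞 hcop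
  obtain ⟨ζ, hζ⟩ := exists_orientation (p := p) ιK n
  obtain ⟨γ₀, hγ₀⟩ := exists_frobLift 𝔣 h𝔣 v vbar h𝔣v hne n
  -- `κ`-representatives by CRT (`𝔣 + vⁿ = 1`), k2-g40 `exists_kappaReps` inline
  have hα : ∀ a : (ZMod (p ^ n))ˣ, ∃ x : 𝓞 K,
      x - 1 ∈ 𝔣 ∧ x - ((a : ZMod (p ^ n)).val : 𝓞 K) ∈ v.asIdeal ^ n := by
    intro a
    obtain ⟨x, hx, y, hy, hxy⟩ := Ideal.isCoprime_iff_exists.mp h𝔣v.pow_right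
    refine ⟨1 + ((((a : ZMod (p ^ n)).val : ℕ) : 𝓞 K) - 1) * x, ?_, ?_⟩
    · have : 1 + ((((a : ZMod (p ^ n)).val : ℕ) : 𝓞 K) - 1) * x - 1 =
          ((((a : ZMod (p ^ n)).val : ℕ) : 𝓞 K) - 1) * x := by ring
      rw [this]; exact 𝔣.mul_mem_left _ hx
    · have hx' : x = 1 - y := by rw [← hxy]; ring
      have : 1 + ((((a : ZMod (p ^ n)).val : ℕ) : 𝓞 K) - 1) * x - (((a : ZMod (p ^ n)).val : ℕ) : 𝓞 K) =
          -(((((a : ZMod (p ^ n)).val : ℕ) : 𝓞 K) - 1) * y) := by rw [hx']; ring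
      rw [this]; exact (v.asIdeal ^ n).neg_mem ((v.asIdeal ^ n).mul_mem_left _ hy)
  choose α hα using hα
  have htc : 𝒰.IsTowerContinuous (galCharInv ι (𝔣 * v.asIdeal ^ n) χ) :=
    isTowerContinuous_galCharInv ι hv hvbar h𝔤 (supp_mul_pow hsupp n) χ hU hN
  exact ⟨L, La, T, u, ζ, γ₀, α, hL, hLa, hT, hu, hζ, hγ₀, hα,
    hcv ιK hιK 𝔣 n hn h𝔣 h𝔣v hsupp hw 𝔞 hcop L La T hL hLa hT u hu χ hχ htc ζ hζ γ₀ hγ₀ α hα⟩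

/-! ## §7 Frame form `∫χ̂⁻¹ dμ = c(key)·G(χ⁻¹)·Σ` (k2-g40's consumer lemma + non-vanishing, inline) -/

/-- The smoothing factor `12(χ⁻¹(𝔞) − N𝔞)` is non-zero for `N𝔞 ≥ 2` (k2-g40 `smoothingFactor_ne_zero`,
verbatim: root of unity vs. integer, `ι⁻¹` injective). [cite: deShalit1987, II.5.2 (3) (p. 79)] -/
theorem smoothingFactor_ne_zero (ι : PadicAlgCl p ≃+* ℂ) {𝔤 : Ideal (𝓞 K)}
    (χ : RayGal K 𝔤 →* ℂˣ) (g : RayGal K 𝔤) {N : ℕ} (hN : 2 ≤ N) :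
    12 * (cval ι (χ g)⁻¹ - (N : ℂ_[p])) ≠ 0 := by
  have hfin : IsOfFinOrder (χ g)⁻¹ :=
    isOfFinOrder_inv_iff.mpr (χ.isOfFinOrder (isOfFinOrder_of_finite g))
  have hnorm : ‖(((χ g)⁻¹ : ℂˣ) : ℂ)‖ = 1 := by
    obtain ⟨k, hk, hk1⟩ := hfin.exists_pow_eq_one
    have h1 : ‖(((χ g)⁻¹ : ℂˣ) : ℂ)‖ ^ k = 1 := by
      rw [← norm_pow, ← Units.val_pow_eq_pow_val, hk1, Units.val_one, norm_one]
    exact (pow_eq_one_iff_of_nonneg (norm_nonneg _) hk.ne').mp h1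
  have hneC : (((χ g)⁻¹ : ℂˣ) : ℂ) ≠ (N : ℂ) := by
    intro h
    have : ‖(N : ℂ)‖ = 1 := h ▸ hnorm
    rw [Complex.norm_natCast] at this
    have : (N : ℝ) = 1 := this
    norm_cast at this
    omega
  refine mul_ne_zero (by norm_num) (sub_ne_zero.mpr ?_)
  intro h
  apply hneC
  unfold cval at h
  have h1 : ((ι.symm (((χ g)⁻¹ : ℂˣ) : ℂ) : PadicAlgCl p) : ℂ_[p]) = ((N : PadicAlgCl p) : ℂ_[p]) := by
    rw [PadicComplex.coe_natCast]; exact h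
  rw [PadicComplex.coe_eq, PadicComplex.coe_eq] at h1
  have h' : (ι.symm (((χ g)⁻¹ : ℂˣ) : ℂ) : PadicAlgCl p) = (N : PadicAlgCl p) :=
    (algebraMap (PadicAlgCl p) ℂ_[p]).injective h1
  have := congrArg ι h'
  simpa using this

omit [Fact p.Prime] in
/-- `N𝔞 ≥ 2` for `𝔞 ≠ 0, 𝒪_K`. [folklore] -/
theorem two_le_absNorm {𝔞 : Ideal (𝓞 K)} (h𝔞 : 𝔞 ≠ ⊥) (h𝔞' : 𝔞 ≠ ⊤) : 2 ≤ Ideal.absNorm 𝔞 := by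
  have h0 : Ideal.absNorm 𝔞 ≠ 0 := fun h ↦ h𝔞 (Ideal.absNorm_eq_zero_iff.mp h)
  have h1 : Ideal.absNorm 𝔞 ≠ 1 := fun h ↦ h𝔞' (Ideal.absNorm_eq_one_iff.mp h)
  omega

/-- **Frame form of the consumer identity** (row 84 / k3-g29 `OutOfRangeLogLaw` currency, B65: the
constant `c(key) = (12(χ⁻¹(𝔞) − N𝔞))⁻¹·G(χ⁻¹)` NAMED, nothing netted): for `𝔞 ≠ 𝒪_K` the identity of
`exists_cosetValueIdentity` divides out to `∫ χ̂⁻¹ dμ = c(key) · G(χ⁻¹) · Σ_g χ(g) Log j_p(g·u)`.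
[cite: deShalit1987, II.5.2 (4) (p. 80)] -/
theorem integral_eq_of_cosetValueIdentity {ι : PadicAlgCl p ≃+* ℂ} {ιK : K →+* ℂ}
    {𝔤 : Ideal (𝓞 K)} {n : ℕ} {𝔞 : Ideal (𝓞 K)} (h𝔞 : 𝔞 ≠ ⊥) (h𝔞' : 𝔞 ≠ ⊤)
    {χ : RayGal K 𝔤 →* ℂˣ} {u : rayClassField K 𝔤}
    {γ₀ : absoluteGaloisGroup K} {ζ : AlgebraicClosure K} {α : (ZMod (p ^ n))ˣ → 𝓞 K}
    {𝒰 : SubgroupTower (absoluteGaloisGroup K)} {μ : GroupDistribution 𝒰 ℂ_[p]}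
    (h : CosetValueIdentity ι ιK 𝔤 n 𝔞 χ u γ₀ ζ α μ) :
    μ.integral (galCharInv ι 𝔤 χ) =
      (12 * (cval ι (χ (artinSymbol (galFrob K (rayClassField K 𝔤)) 𝔞))⁻¹ -
        (Ideal.absNorm 𝔞 : ℂ_[p])))⁻¹ * gaussSumInv ι ιK 𝔤 n χ γ₀ ζ α * unitLogSum ι ιK 𝔤 χ u := by
  have hc := smoothingFactor_ne_zero ι χ (artinSymbol (galFrob K (rayClassField K 𝔤)) 𝔞)
    (two_le_absNorm h𝔞 h𝔞')
  unfold CosetValueIdentity at h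
  rw [mul_assoc, ← h, ← mul_assoc, inv_mul_cancel₀ hc, one_mul]

end Summit.BirchSwinnertonDyer.BirchSwinnertonDyer.Cruxes.SplitBadTwoLowerHalfOfFacts.CosetInstancesK2G42
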